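import Literature.NumberTheory.EllipticCurves.FineSelmerClassGroupCriterion
import HarnessLib

/-!
# Doors from class-group numerics of `ℚ(E[p])` to Coates–Sujatha's statement (A)
# (Coates–Sujatha 2005 Thm. 3.4 ∘ Iwasawa 1956 / Fukuda 1994 Thm. 1) — class-free, by name

WHY (cell `bsd-potss`, seat `conjA-anchor` g8; `--supports` stmt-BirchSwinnertonDyer-19942 / 19916 / 19386 /
19413; closes nothing).  Road (b) of the registered residue skeletons `Cruxes/{Wild,Tame}CoatesSujathaResidue`
(`stub_residue_multiCarrier_anchorOrClassicalMu`, disjunct «`ClassicalMuVanishes κ_L` for every cyclotomic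
`ℤ_p`-extension of `L = ℚ(W[p])`») reaches statement (A) for `E` at `p` through the named fact
`CoatesSujatha2005.thm34_fineSelmerDual_moduleFinite_of_classicalMuVanishes_divisionField` with NO congruence
anchor and NO local condition at `p`.  Its input `μ(L_cyc/L) = 0` is supplied, per curve, by class-group numerics of
`L` through two named facts of `IwasawaTheory/ClassicalMuInvariant.lean`: Iwasawa 1956 (`p ∤ h(L)` and ONE prime of
`L` above `p` ⇒ `e_n = 0` for all `n`) and Fukuda 1994 Thm. 1 (two consecutive layers `n ≥ n₀` with the same
`ord_p h` resp. the same `p`-rank ⇒ `μ = 0`).  The census of the seat (kit j290399 + j289900, `p = 3`, the 493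
U₀-Cartan rows of the K9/KT3 classes; PARI, class groups of degree ≥ 16 under GRH) finds the Iwasawa-1956 door open on
273 rows and a Fukuda door at the layers `(0,1)` on further rows.  This file states the three doors CLASS-FREE and
BY NAME, so that a per-curve record is a one-line application displaying only NUMERIC hypotheses (and, for the Fukuda
doors, Fukuda's index hypothesis `TotallyRamifiedFrom κ_L 0`, which `Summits/…/Theorems/PrintX8SmallImageTotallyRamified`
§2 discharges for `ℚ(W[p])/ℚ` Galois of degree prime to `p`).  The leaf-specific doors of the X8 cell
(`X8.conjA_of_classNumberPExp_one_eq'` etc.) are the case `ClassX8 W p ∧ ¬ Surj W p`; nothing here is new mathematics —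
three proved reading aids composing existing named facts, no new `def … : Prop`.

References: [CoatesSujatha2005] Thm. 3.4 (§3); [Greenberg2001IwasawaPastPresent] Prop. 2.1 p. 339 (Iwasawa 1956);
[Fukuda1994] Thm. 1 (1), (2), p. 264; [Lang1990] Ch. 5 §4 Thm. 4.3.
-/

namespace Literature.NumberTheory.EllipticCurves.CoatesSujatha2005

open WeierstrassCurve Literature.NumberTheory.IwasawaTheory IsDedekindDomain NumberField

/-- **Door 1 (Iwasawa 1956 ∘ Coates–Sujatha Thm. 3.4), by name.**  Granted the named facts
`iwasawa1956_classNumberPExp_eq_zero_of_not_dvd_classNumber_of_unique_prime` (`hIw`) and Coates–Sujatha Thm. 3.4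
(`hCS`): if `p ≠ 2`, `p ∤ h(ℚ(W[p]))` and exactly ONE prime of `ℚ(W[p])` lies above `p`, then statement (A) holds for
`W` at `p` (the dual fine Selmer group over `ℚ_cyc` is `ℤ_p`-finitely generated).  Both displayed hypotheses are
numeric (a class number and a prime decomposition); no anchor, no local torsion condition, no `TotallyRamifiedFrom`.
CONDITIONAL on the two facts; (A) is not asserted unconditionally.
[cite: Greenberg2001IwasawaPastPresent, Prop. 2.1 p. 339] [cite: CoatesSujatha2005, Thm. 3.4 (§3)] -/
theorem fineSelmerDual_moduleFinite_of_not_dvd_classNumber_of_unique_prime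
    (hIw : iwasawa1956_classNumberPExp_eq_zero_of_not_dvd_classNumber_of_unique_prime)
    (hCS : thm34_fineSelmerDual_moduleFinite_of_classicalMuVanishes_divisionField)
    (W : WeierstrassCurve ℚ) [W.IsElliptic] (p : ℕ) [Fact p.Prime] (hp : p ≠ 2)
    (hh : haveI : NeZero p := ⟨(Fact.out : p.Prime).ne_zero⟩
      haveI : NumberField (W.divisionField p) := NumberField.mk
      ¬ p ∣ NumberField.classNumber (W.divisionField p))
    (hv : haveI : NeZero p := ⟨(Fact.out : p.Prime).ne_zero⟩
      haveI : NumberField (W.divisionField p) := NumberField.mk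
      ∃! v : HeightOneSpectrum (𝓞 (W.divisionField p)), ((p : ℕ) : 𝓞 (W.divisionField p)) ∈ v.asIdeal)
    (κ : ZpExtension ℚ p) (hκ : κ.IsCyclotomic) :
    ∃ (γ : Field.absoluteGaloisGroup ℚ) (D : W.FineSelmerDualData κ γ),
      Module.Finite ℤ_[p] (RestrictScalars ℤ_[p] (IwasawaAlgebra p) D.X) := by
  haveI : NeZero p := ⟨(Fact.out : p.Prime).ne_zero⟩
  haveI : NumberField (W.divisionField p) := NumberField.mk
  refine hCS W p hp ?_ κ hκ
  intro κL _hL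
  exact classicalMuVanishes_of_classNumberPExp_eq_zero hIw hh hv κL

/-- **Door 2 (Fukuda 1994 Thm. 1 (1) ∘ Coates–Sujatha Thm. 3.4), by name, at any layer `n`.**  Granted Fukuda's
Thm. 1 (1) (`hF1`) and Coates–Sujatha Thm. 3.4 (`hCS`): if `p ≠ 2`, every cyclotomic `ℤ_p`-extension `κ_L` of
`L = ℚ(W[p])` has Fukuda's index `n₀ = 0` (`TotallyRamifiedFrom κ_L 0` — true whenever `L/ℚ` is Galois of degree
prime to `p`, discharged in `Summits/…/Theorems/PrintX8SmallImageTotallyRamified` §2) and `ord_p h(L_{n+1}) = ord_p h(L_n)`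
for ONE `n`, then statement (A) holds for `W` at `p`.  CONDITIONAL on the two facts; (A) not asserted.
[cite: Fukuda1994, Thm. 1 (1), p. 264] [cite: CoatesSujatha2005, Thm. 3.4 (§3)] -/
theorem fineSelmerDual_moduleFinite_of_classNumberPExp_succ_eq
    (hF1 : fukuda1994_thm1_classNumberPExp_const_of_succ_eq)
    (hCS : thm34_fineSelmerDual_moduleFinite_of_classicalMuVanishes_divisionField)
    (W : WeierstrassCurve ℚ) [W.IsElliptic] (p : ℕ) [Fact p.Prime] (hp : p ≠ 2) (n : ℕ)
    (hram : haveI : NeZero p := ⟨(Fact.out : p.Prime).ne_zero⟩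
      ∀ κL : ZpExtension (W.divisionField p) p, κL.IsCyclotomic → TotallyRamifiedFrom κL 0)
    (hord : haveI : NeZero p := ⟨(Fact.out : p.Prime).ne_zero⟩
      ∀ κL : ZpExtension (W.divisionField p) p, κL.IsCyclotomic →
        classNumberPExp κL (n + 1) = classNumberPExp κL n)
    (κ : ZpExtension ℚ p) (hκ : κ.IsCyclotomic) :
    ∃ (γ : Field.absoluteGaloisGroup ℚ) (D : W.FineSelmerDualData κ γ),
      Module.Finite ℤ_[p] (RestrictScalars ℤ_[p] (IwasawaAlgebra p) D.X) := by
  haveI : NeZero p := ⟨(Fact.out : p.Prime).ne_zero⟩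
  haveI : NumberField (W.divisionField p) := NumberField.mk
  refine hCS W p hp ?_ κ hκ
  intro κL hL
  exact classicalMuVanishes_of_classNumberPExp_succ_eq hF1 κL (hram κL hL) (Nat.zero_le n) (hord κL hL)

/-- **Door 3 (Fukuda 1994 Thm. 1 (2) ∘ Coates–Sujatha Thm. 3.4), by name, at any layer `n`.**  As Door 2 with the
`p`-RANK certificate `rank_p Cl(L_{n+1}) = rank_p Cl(L_n)` (Fukuda's Thm. 1 (2), `hF2`) in place of the order
certificate.  CONDITIONAL on the two facts; (A) not asserted.
[cite: Fukuda1994, Thm. 1 (2), p. 264] [cite: CoatesSujatha2005, Thm. 3.4 (§3)] -/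
theorem fineSelmerDual_moduleFinite_of_classGroupPRank_succ_eq
    (hF2 : fukuda1994_thm1_classGroupPRank_const_of_succ_eq)
    (hCS : thm34_fineSelmerDual_moduleFinite_of_classicalMuVanishes_divisionField)
    (W : WeierstrassCurve ℚ) [W.IsElliptic] (p : ℕ) [Fact p.Prime] (hp : p ≠ 2) (n : ℕ)
    (hram : haveI : NeZero p := ⟨(Fact.out : p.Prime).ne_zero⟩
      ∀ κL : ZpExtension (W.divisionField p) p, κL.IsCyclotomic → TotallyRamifiedFrom κL 0)
    (hrk : haveI : NeZero p := ⟨(Fact.out : p.Prime).ne_zero⟩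
      ∀ κL : ZpExtension (W.divisionField p) p, κL.IsCyclotomic →
        classGroupPRank κL (n + 1) = classGroupPRank κL n)
    (κ : ZpExtension ℚ p) (hκ : κ.IsCyclotomic) :
    ∃ (γ : Field.absoluteGaloisGroup ℚ) (D : W.FineSelmerDualData κ γ),
      Module.Finite ℤ_[p] (RestrictScalars ℤ_[p] (IwasawaAlgebra p) D.X) := by
  haveI : NeZero p := ⟨(Fact.out : p.Prime).ne_zero⟩
  haveI : NumberField (W.divisionField p) := NumberField.mk
  refine hCS W p hp ?_ κ hκ
  intro κL hL
  exact classicalMuVanishes_of_classGroupPRank_succ_eq hF2 κL (hram κL hL) (Nat.zero_le n) (hrk κL hL)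

end Literature.NumberTheory.EllipticCurves.CoatesSujatha2005

/-! ## APPEND (seat `bsd-potss-conjA-anchor` g9, 2026-08-28): the same three doors through a SUBFIELD
`L ⊆ ℚ(W[p])` of `p`-power index (Lim 2017 Thm. 3.5 + Lemma 3.2 in place of Coates–Sujatha Thm. 3.4)

WHY.  Coates–Sujatha's Thm. 3.4 asks for Iwasawa's `μ = 0` on the whole division field `ℚ(W[p])`; Lim's
`L`-form (`Lim2017.thm35_fineSelmerDual_moduleFinite_of_classicalMuVanishes_of_le_divisionField`, this topic,
file `FineSelmerClassGroupCriterion.lean`) asks for it only on a subfield `L` with `[ℚ(W[p]) : L]` a power of `p`.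
The largest `p`-subgroup of `G = Gal(ℚ(W[p])/ℚ) ≤ GL₂(𝔽_p)` has order `1` or `p` (`p ∥ #GL₂(𝔽_p)`), so the
SMALLEST admissible `L` is the fixed field of a Sylow `p`-subgroup — the unipotent stabiliser
`U_P = {σ : σP = P, σ ≡ 1 on W[p]/⟨P⟩}` of a non-zero `P ∈ W[p]`, whose fixed field is `ℚ(P, μ_p)` (Weil pairing).
On the rows of the cell's census with `p ∤ #G` (Cartan image) this is `ℚ(W[p])` itself and nothing changes; on
the rows with `p ∣ #G` — at `p = 3` the `GL₂(𝔽₃)`-image («surj», `9`-deficient) rows, `#G = 48` — the door opens on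
a field of degree `#G / p` (`16` instead of `48`), where «one prime above `p`» is possible and class groups are
computable.  The three theorems below are the `L`-forms of Doors 1–3 above: proved reading aids composing named
facts of the tree, displaying only NUMERIC hypotheses on `L` (+ Fukuda's index hypothesis for Doors 2–3); no new
`def … : Prop`.  The class-number hypothesis is written `¬ p ∣ Nat.card (ClassGroup (𝓞 L))` so that no
`NumberField` instance on the subfield is needed to STATE it (inside the proof `L` is a number field as a subfield
of the finite extension `ℚ(W[p])`, and `Nat.card = NumberField.classNumber`).

References: [Lim2017FineSelmer] §3 Thm. 3.5, Lemma 3.2, Remark (a) (arXiv:1306.2047 pp. 6–7);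
[Greenberg2001IwasawaPastPresent] Prop. 2.1 p. 339 (Iwasawa 1956); [Fukuda1994] Thm. 1 (1), (2), p. 264;
[SerreAbelianLadic1968] IV.3.1–3.2 (`p`-subgroups of `GL₂(𝔽_p)`).
-/

namespace Literature.NumberTheory.EllipticCurves.Lim2017

open WeierstrassCurve Literature.NumberTheory.IwasawaTheory IsDedekindDomain NumberField

/-- A subfield of the (finite) division field is finite over `ℚ` (bookkeeping). [folklore] -/
private theorem finiteDimensional_of_le_divisionField (W : WeierstrassCurve ℚ) [W.IsElliptic] (p : ℕ)
    [NeZero p] {L : IntermediateField ℚ (AlgebraicClosure ℚ)} (hL : L ≤ W.divisionField p) :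
    FiniteDimensional ℚ L :=
  FiniteDimensional.of_injective (IntermediateField.inclusion hL).toLinearMap
    (IntermediateField.inclusion_injective hL)

/-- **Door 1′ (Iwasawa 1956 ∘ Lim 2017 Thm. 3.5 / Lemma 3.2), by name, on a subfield of `p`-power index.**
Granted the named facts `iwasawa1956_classNumberPExp_eq_zero_of_not_dvd_classNumber_of_unique_prime` (`hIw`) and
Lim's `L`-form of the class-group road (`hLim`): if `p ≠ 2`, `L ⊆ ℚ(W[p])` with `[ℚ(W[p]) : ℚ] = p^k · [L : ℚ]`,
`p ∤ h(L)` and exactly ONE prime of `L` lies above `p`, then statement (A) holds for `W` at `p` (the dual fine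
Selmer group over `ℚ_cyc` is `ℤ_p`-finitely generated).  Displayed hypotheses on `L`: a degree relation, a class
number, a prime decomposition — no anchor, no local torsion condition, no `TotallyRamifiedFrom`.  With
`L = ℚ(W[p])`, `k = 0` this is Door 1.  CONDITIONAL on the two facts; (A) is not asserted unconditionally.
[cite: Lim2017FineSelmer, §3 Thm. 3.5 and Lemma 3.2 (arXiv:1306.2047 pp. 6–7)]
[cite: Greenberg2001IwasawaPastPresent, Prop. 2.1 p. 339] -/
theorem fineSelmerDual_moduleFinite_of_not_dvd_card_classGroup_of_unique_prime_of_le_divisionField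
    (hIw : iwasawa1956_classNumberPExp_eq_zero_of_not_dvd_classNumber_of_unique_prime)
    (hLim : thm35_fineSelmerDual_moduleFinite_of_classicalMuVanishes_of_le_divisionField)
    (W : WeierstrassCurve ℚ) [W.IsElliptic] (p : ℕ) [Fact p.Prime] (hp : p ≠ 2)
    (L : IntermediateField ℚ (AlgebraicClosure ℚ))
    (hL : haveI : NeZero p := ⟨(Fact.out : p.Prime).ne_zero⟩; L ≤ W.divisionField p)
    (hk : haveI : NeZero p := ⟨(Fact.out : p.Prime).ne_zero⟩
      ∃ k : ℕ, Module.finrank ℚ (W.divisionField p) = p ^ k * Module.finrank ℚ L)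
    (hh : ¬ p ∣ Nat.card (ClassGroup (𝓞 L)))
    (hv : ∃! v : HeightOneSpectrum (𝓞 L), ((p : ℕ) : 𝓞 L) ∈ v.asIdeal)
    (κ : ZpExtension ℚ p) (hκ : κ.IsCyclotomic) :
    ∃ (γ : Field.absoluteGaloisGroup ℚ) (D : W.FineSelmerDualData κ γ),
      Module.Finite ℤ_[p] (RestrictScalars ℤ_[p] (IwasawaAlgebra p) D.X) := by
  haveI : NeZero p := ⟨(Fact.out : p.Prime).ne_zero⟩
  haveI : FiniteDimensional ℚ L := finiteDimensional_of_le_divisionField W p hL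
  haveI : NumberField L := NumberField.mk
  refine hLim W p hp L hL hk ?_ κ hκ
  intro κL _hκL
  have hh' : ¬ p ∣ NumberField.classNumber L := by
    rwa [NumberField.classNumber, ← Nat.card_eq_fintype_card]
  exact classicalMuVanishes_of_classNumberPExp_eq_zero hIw hh' hv κL

/-- **Door 2′ (Fukuda 1994 Thm. 1 (1) ∘ Lim 2017 Thm. 3.5 / Lemma 3.2), by name, at any layer `n`, on a subfield of
`p`-power index.**  Granted Fukuda's Thm. 1 (1) (`hF1`) and Lim's `L`-form (`hLim`): if `p ≠ 2`, `L ⊆ ℚ(W[p])` with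
`[ℚ(W[p]) : ℚ] = p^k · [L : ℚ]`, every cyclotomic `ℤ_p`-extension `κ_L` of `L` has Fukuda's index `n₀ = 0`
(`TotallyRamifiedFrom κ_L 0`) and `ord_p h(L_{n+1}) = ord_p h(L_n)` for ONE `n`, then statement (A) holds for `W`
at `p`.  With `L = ℚ(W[p])` this is Door 2.  CONDITIONAL on the two facts; (A) not asserted.
[cite: Lim2017FineSelmer, §3 Thm. 3.5 and Lemma 3.2 (arXiv:1306.2047 pp. 6–7)] [cite: Fukuda1994, Thm. 1 (1), p. 264] -/
theorem fineSelmerDual_moduleFinite_of_classNumberPExp_succ_eq_of_le_divisionField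
    (hF1 : fukuda1994_thm1_classNumberPExp_const_of_succ_eq)
    (hLim : thm35_fineSelmerDual_moduleFinite_of_classicalMuVanishes_of_le_divisionField)
    (W : WeierstrassCurve ℚ) [W.IsElliptic] (p : ℕ) [Fact p.Prime] (hp : p ≠ 2) (n : ℕ)
    (L : IntermediateField ℚ (AlgebraicClosure ℚ))
    (hL : haveI : NeZero p := ⟨(Fact.out : p.Prime).ne_zero⟩; L ≤ W.divisionField p)
    (hk : haveI : NeZero p := ⟨(Fact.out : p.Prime).ne_zero⟩
      ∃ k : ℕ, Module.finrank ℚ (W.divisionField p) = p ^ k * Module.finrank ℚ L)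
    (hram : ∀ κL : ZpExtension L p, κL.IsCyclotomic → TotallyRamifiedFrom κL 0)
    (hord : ∀ κL : ZpExtension L p, κL.IsCyclotomic → classNumberPExp κL (n + 1) = classNumberPExp κL n)
    (κ : ZpExtension ℚ p) (hκ : κ.IsCyclotomic) :
    ∃ (γ : Field.absoluteGaloisGroup ℚ) (D : W.FineSelmerDualData κ γ),
      Module.Finite ℤ_[p] (RestrictScalars ℤ_[p] (IwasawaAlgebra p) D.X) := by
  haveI : NeZero p := ⟨(Fact.out : p.Prime).ne_zero⟩
  haveI : FiniteDimensional ℚ L := finiteDimensional_of_le_divisionField W p hL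
  haveI : NumberField L := NumberField.mk
  refine hLim W p hp L hL hk ?_ κ hκ
  intro κL hκL
  exact classicalMuVanishes_of_classNumberPExp_succ_eq hF1 κL (hram κL hκL) (Nat.zero_le n) (hord κL hκL)

/-- **Door 3′ (Fukuda 1994 Thm. 1 (2) ∘ Lim 2017 Thm. 3.5 / Lemma 3.2), by name, at any layer `n`, on a subfield of
`p`-power index.**  As Door 2′ with the `p`-RANK certificate `rank_p Cl(L_{n+1}) = rank_p Cl(L_n)` (Fukuda's
Thm. 1 (2), `hF2`) in place of the order certificate.  With `L = ℚ(W[p])` this is Door 3.  CONDITIONAL on the two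
facts; (A) not asserted.
[cite: Lim2017FineSelmer, §3 Thm. 3.5 and Lemma 3.2 (arXiv:1306.2047 pp. 6–7)] [cite: Fukuda1994, Thm. 1 (2), p. 264] -/
theorem fineSelmerDual_moduleFinite_of_classGroupPRank_succ_eq_of_le_divisionField
    (hF2 : fukuda1994_thm1_classGroupPRank_const_of_succ_eq)
    (hLim : thm35_fineSelmerDual_moduleFinite_of_classicalMuVanishes_of_le_divisionField)
    (W : WeierstrassCurve ℚ) [W.IsElliptic] (p : ℕ) [Fact p.Prime] (hp : p ≠ 2) (n : ℕ)
    (L : IntermediateField ℚ (AlgebraicClosure ℚ))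
    (hL : haveI : NeZero p := ⟨(Fact.out : p.Prime).ne_zero⟩; L ≤ W.divisionField p)
    (hk : haveI : NeZero p := ⟨(Fact.out : p.Prime).ne_zero⟩
      ∃ k : ℕ, Module.finrank ℚ (W.divisionField p) = p ^ k * Module.finrank ℚ L)
    (hram : ∀ κL : ZpExtension L p, κL.IsCyclotomic → TotallyRamifiedFrom κL 0)
    (hrk : ∀ κL : ZpExtension L p, κL.IsCyclotomic → classGroupPRank κL (n + 1) = classGroupPRank κL n)
    (κ : ZpExtension ℚ p) (hκ : κ.IsCyclotomic) :
    ∃ (γ : Field.absoluteGaloisGroup ℚ) (D : W.FineSelmerDualData κ γ),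
      Module.Finite ℤ_[p] (RestrictScalars ℤ_[p] (IwasawaAlgebra p) D.X) := by
  haveI : NeZero p := ⟨(Fact.out : p.Prime).ne_zero⟩
  haveI : FiniteDimensional ℚ L := finiteDimensional_of_le_divisionField W p hL
  haveI : NumberField L := NumberField.mk
  refine hLim W p hp L hL hk ?_ κ hκ
  intro κL hκL
  exact classicalMuVanishes_of_classGroupPRank_succ_eq hF2 κL (hram κL hκL) (Nat.zero_le n) (hrk κL hκL)

end Literature.NumberTheory.EllipticCurves.Lim2017
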